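import Summits.QuantumFields.YangMills.Theorems.UnitScaleTiltHalvingStubOfHP1Room
import Summits.QuantumFields.YangMills.Theorems.UnitScaleTiltHalvingStepOfPillarsCERowsStatGrowth
import HarnessLib

/-!
# Route `UnitScaleTilt`, crux K1 child «MinimiserStabilityRegPr» (stmt-QuantumFields-19200), registered stub `stub_halvingStep` (v10 `BirthV10`) —
# **PREFIX «ρ5» = ρ4 + THE p. 98 SUB-LATTICE GUARD + THE (M2′) `Cr`-WINDOW: THE ONE-HYPOTHESIS H DOOR** — `stub_halvingStep_of_hP1roomρ5 (hP1roomρ5) :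
# <BirthV10.stub_halvingStep VERBATIM>`, the byte-twin of ✓`HalvingStubOfHP1RoomRho4.stub_halvingStep_of_hP1roomρ4` whose displayed text `hP1roomρ5` names, per `L`,
# three more letters `(sx ρ₅ : ℕ) (Cθ : ℝ)` and carries THREE more antecedents right after `12(ρ+M)a ≤ Cr →`:
#   `Cθ * ((ρ + M + L + S : ℕ) : ℝ) ≤ Cr → L ^ (sx + 1) ∣ ρ + M + L + S → ρ₅ ≤ ρ →`.
# THE DOOR PAYS ALL THREE (§1): (i) `Cr := max (4C′B₀B₃) (Cθ·(ρ+M+L+S))` — `Cr` is used only monotonically (`8 ≤ Cr`, the ceiling `a ≤ Cr∕(12(ρ+M))`, the P1♭ call which is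
# ∀ `Cr > 4`, the stub's `B₃ := Cr`, and the halving threshold `¼·max (Crε₁) (ε₀∕2)` — now by `max_le_max`), while the (163) row `h163` keeps the letter `4C′B₀B₃`
# (ym-ust-20520-w5 g9 LOCATE 01:22:10Z: `ρ` is fixed BEFORE `Cr`, no feedback); (ii)+(iii) `aₑ := max (max (max M₁ M₀) Mₚ) (sx+1)` makes `M = L^{aₑ}` and `S = R·M`
# multiples of `L^{sx+1}`, and `ρ` is drawn by ✓`HalvingRhoLinearBricks.exists_rho_163_pow_ge_mod` (★w3-20520 g8, landed for this use) with floor `ρ₅` in the residue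
# class `ρ ≡ −L [L^{sx+1}]`, so `L^{sx+1} ∣ ρ + M + L + S` — every member sits on [Balaban1985RegularSpaces] p. 98's sub-lattice, where px10 g3's (γ-6)
# `…H59GammaDischargeFlatRho5` turns the displayed (1.59) rows into theorems, and the (M2′) fat-loop window `c″ρ′²ε₁ ≤ …` follows from `Cr·ε₁ ≤ ε₀` (w5 g9).
# Design: ★w3-20520 g8 LOCATE 01:26:52Z∕01:36:05Z; companion ✓`HalvingP1FlatPillarRoomOfSuppliersRho5.hP1roomρ5_of_suppliers (hSupUρ5) : hP1roomρ5`.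

Cell `ym3-torus` (HUMAN RULING D-0037, YM ladder rung R3 — YM₃ on T³ is a RUNG, not the Clay problem), width seat `ym-ust-20520-w3` gen 8.
`--supports stmt-QuantumFields-19200 --as helper`; count-neutral; def-free, 0 sorry, standard axioms.  `hP1roomρ5` is a HYPOTHESIS; nothing here claims the stub, the crux,
the rung or the mass gap; no summit statement is proved by this seat.
* §1 ★★ `roomHalvingStat_of_rows_rho5 (hP2) (hP1roomρ5) (hCEgrowth)` : ✓`roomHalvingStat_of_rows_rho4`'s conclusion VERBATIM — its proof with the three discharges above.
* §2 ★★★ **`stub_halvingStep_of_hP1roomρ5 (hP1roomρ5) : <stub VERBATIM>`** — H-SMALL lift ✓`statLift`, P2 ✓`hP2_holds`, growth-exposed C_E ✓`ceRows_of_chart_stat_growth_room`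
  discharged by name, as in ✓`…Rho4`.
INHABITABILITY (OWNER №9 (3)): `hP1roomρ5` is WEAKER than ✓`hP1roomρ4` (three more antecedents, three more ∃-letters instantiable by `sx := 0, ρ₅ := 0, Cθ := 0`) —
inhabited by ✓`hP1roomρ4_of_suppliers` ∘ ✓`hSupUρ4_of_socketsγ` (v7γ) already; door side — kernel (this file).
HONEST SCOPE.  Assembly + forty lines of `Nat`∕`max` arithmetic; NOT a claim about the stub, the crux, the rung or the mass gap.

References: T. Bałaban, CMP **102** (1985) 277–309 [Balaban1985Variational] (111) p.294, (141)–(144) p.300, (152)–(168) pp.301–304, Prop. 8 p.304; CMP **99** (1985)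
75–102 [Balaban1985RegularSpaces] Thm 2 p.83, (1.33)–(1.38) p.82, (1.65)–(1.66) p.87, p.98, (1.140) p.100.
-/

set_option autoImplicit false

noncomputable section

open scoped BigOperators Matrix.Norms.L2Operator

namespace Summit.QuantumFields.YangMills.Theorems.HalvingStubOfHP1RoomRho5

open Literature.MathematicalPhysics.QuantumFieldTheory.Balaban1983to89
open Literature.MathematicalPhysics.QuantumFieldTheory.Balaban1983to89.T3ContinuumYM3Torus
open Literature.MathematicalPhysics.QuantumFieldTheory.Balaban1983to89.T3PrintedRegularMinimiser
open Literature.MathematicalPhysics.QuantumFieldTheory.Balaban1983to89.T3PrintedMinimiserExistence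
open Literature.MathematicalPhysics.QuantumFieldTheory.Balaban1983to89.T3Thm1Carrier
open Literature.MathematicalPhysics.QuantumFieldTheory.Balaban1983to89.T3Thm1CarrierNative (IsCritR2)
open Literature.MathematicalPhysics.QuantumFieldTheory.Balaban1983to89.T3UnitLawDensityEML (ℰp)
open Literature.MathematicalPhysics.QuantumFieldTheory.Balaban1983to89.T3ConstrainedMinimiser (fibre)
open Complex (I)
open B5Eq117TorusCarriers (Mk)
open B5Eq118OneStroke (iterBlockOf)
open B5Prop12FieldsLattice (distSite distSite_self)
open B6SectADomainsV1 (Domains)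
open B6SectAOperatorsV1 (BondIdx SiteIdx)
open B7Prop1Explicit (expUnit)
open B7Eq92Concrete (mgauge)
open B8Ineq132 (BondTouches)
open B8Eq140Level (SideTouches sideTouches_mono Cond140)
open B8Eq143PlaqExpansion (pdiv)
open B8Eq146AExpansion (plaqCovDeriv)
open B8Eq184Proof (cfgExp)
open B8Thm2SetupTorus (cfgPull gaugePull pullDom)
open B10Eq27TorusAxialLog (pull unitsField toUField transl)
open B11Eq115Space (levOf)
open LatticeFieldCalculus (bondAvgIter laplace diverg siteAvgIter)
open FlatCubeOpsText (Adm22 IsLevWeight FlatOpsAdmAtMS)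
open FlatCubeSequenceAligned (cubeSeqMT3)
open FlatCubeSequenceAdm (adm22_cubeSeqMT3)
open FlatOpsLettersAssembly (flatH isFlatH_flatH)
open HalvingQuarterCubeSeq (inOm_top_of_dist)
open HalvingP1FlatPillar (DP1Clause P1FlatPillarAt P1FlatPillar)
open HalvingP1FlatPillarPrime (P1FlatPillarAt' P1FlatPillar' sideTouches_subset_cube0)
open HalvingStepOfPillars (layerChart_of_memberChart)
open HalvingAssemblyInterior (siteClause_of_pieces_int)
open HalvingStepOfPillarsRoom (regPrHalving_of_memberCharts)
open FlatCubeSequenceAligned (cubeSetM)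
open HalvingSitePackage (sitePackage_of_rows)
open Summit.QuantumFields.YangMills.Theorems.Prop8ChartDoubleBar (chartLogFlat)
open HalvingRhoLinearBricks (exists_rho_163_pow_ge_mod package_const_le)
open HalvingSitePackage (ceRows_of_chart_stat_growth_room)

/-! ## §1 The room halving in stationarity currency from the three displayed texts, prefix «ρ5» -/

section Door

set_option maxHeartbeats 400000 in
/-- ★★ **THE ROOM HALVING, STATIONARITY CURRENCY, FROM THE THREE DISPLAYED TEXTS — PREFIX «ρ5»**: ✓`HalvingStubOfHP1RoomRho4.roomHalvingStat_of_rows_rho4` with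
`hP1roomρ4 ↦ hP1roomρ5` (per `L` three more letters `sx ρ₅ Cθ`; three more antecedents `Cθ·(ρ+M+L+S) ≤ Cr`, `L^(sx+1) ∣ ρ+M+L+S`, `ρ₅ ≤ ρ`, discharged at
`Cr := max (4C′B₀B₃) (Cθ·(ρ+M+L+S))`, `aₑ ≥ sx+1` and `ρ` from ✓`exists_rho_163_pow_ge_mod` in the class `ρ ≡ −L [L^(sx+1)]` above `ρ₅`); conclusion VERBATIM, proof
✓`…rho4`'s with those discharges and the halving threshold compared by `max_le_max`.
[cite: Balaban1985Variational, (111) p.294, (144) p.300, (152)-(168) pp.301-304, Prop. 8 p.304; Balaban1985RegularSpaces, Thm 2 p.83, (1.33)-(1.38) p.82, p.98, (1.140) p.100] -/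
theorem roomHalvingStat_of_rows_rho5
    (hP2 : ∀ L : ℕ, Odd L → 1 < L → ∃ (R₀ M₀ : ℕ) (B₀ δ₀ B₃ : ℝ), 0 < B₀ ∧ 0 < δ₀ ∧ 0 < B₃ ∧ FlatOpsAdmAtMS L R₀ M₀ B₀ δ₀ B₃)
    (hP1roomρ5 : ∀ L : ℕ, Odd L → 1 < L → ∃ (Mₚ Rₚ sx ρ₅ : ℕ) (Cθ : ℝ), ∀ (R M aₑ S : ℕ) (hM : 1 ≤ M), M = L ^ aₑ → Mₚ ≤ M → Rₚ ≤ R → R * M ≤ S →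
      ∃ B₁ : ℝ, 0 ≤ B₁ ∧ ∃ Nr : ℕ, ∃ Cρ : ℝ, 0 < Cρ ∧ ∃ qρ : ℕ,
      ∀ (ρ : ℕ) (a Cr : ℝ), 0 < Cr → 4 < Cr → 12 * ((ρ : ℝ) + (M : ℝ)) * a ≤ Cr → Cθ * ((ρ + M + L + S : ℕ) : ℝ) ≤ Cr → L ^ (sx + 1) ∣ ρ + M + L + S → ρ₅ ≤ ρ →
        16 * 3800 * ((5 * L : ℕ) : ℝ) ^ 2 * (L : ℝ) * ((B₁ * ((ρ : ℝ) + 1) ^ qρ + 1) * a) ≤ 1 → Cρ * ((ρ : ℝ) + 1) ^ qρ * a ≤ 1 →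
        ∀ F : T3Family, F.L = L → ∀ (n K : ℕ) (hnK : n < K), 2 * ρ + Nr ≤ F.L ^ (F.m + n) →
          ∀ (ε₀ ε₁ : ℝ), 0 < ε₁ → 0 < ε₀ → ε₀ ≤ a → Cr * ε₁ ≤ ε₀ →
          ∀ V : GaugeField (F.P n) 0 (Matrix.specialUnitaryGroup (Fin 2) ℂ), PlaqSmall ε₁ V →
            ∀ U ∈ regFibrePr F n K hnK.le ε₀ V, ∀ x : Site (F.P K) 0,
              P1FlatPillarAt' F n K (cubeSeqMT3 F n K x ρ S M hM) (cubeSetM x (K - n) ρ S M 0) x ε₀ ε₁ (B₁ * ((ρ : ℝ) + 1) ^ qρ) 6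
                (8 * (L : ℝ) * (B₁ * ((ρ : ℝ) + 1) ^ qρ + 1)) U)
    (hCEgrowth : ∀ L : ℕ, Odd L → 1 < L → ∀ (R₀ M₀ : ℕ) (B₀ δ₀ B₃ : ℝ), 0 < B₀ → 0 < δ₀ → 0 < B₃ → FlatOpsAdmAtMS L R₀ M₀ B₀ δ₀ B₃ →
      ∃ (M₁ R₁ : ℕ), ∀ (R M aₑ S : ℕ) (hM : 1 ≤ M), M = L ^ aₑ → M₁ ≤ M → M₀ ≤ M → R₁ ≤ R → R₀ ≤ R → R * M ≤ S →
      ∃ (Nce : ℕ) (k₁ k₂ c₂ ace : ℝ), 0 ≤ k₁ ∧ 0 ≤ k₂ ∧ 0 ≤ c₂ ∧ 0 < ace ∧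
      ∀ B₁ : ℝ, 0 ≤ B₁ →
      ∀ ρ : ℕ, 1 ≤ ρ → ∀ F : T3Family, F.L = L → ∀ (n K : ℕ) (hnK : n < K), Nce ≤ F.L ^ (F.m + n) →
        ∀ (ε₀ ε₁ : ℝ), 0 < ε₁ → 0 < ε₀ → ε₀ ≤ ace / (B₁ + 1) →
        ∀ V : GaugeField (F.P n) 0 (Matrix.specialUnitaryGroup (Fin 2) ℂ), PlaqSmall ε₁ V →
          ∀ U ∈ regFibrePr F n K hnK.le ε₀ V,
            (∀ γ : ℝ → GaugeField (F.P K) 0 (Matrix.specialUnitaryGroup (Fin 2) ℂ), γ 0 = U → (∀ t, γ t ∈ fibre F ℰp n K hnK.le V) →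
              (∀ b, DifferentiableAt ℝ (fun t => ((γ t b : Matrix.specialUnitaryGroup (Fin 2) ℂ) : Matrix (Fin 2) (Fin 2) ℂ)) 0) →
                deriv (fun t => wilsonAction4 (γ t)) 0 = 0) →
            ∀ (x : Site (F.P K) 0) (C₂' : ℝ) (u : GaugeTransf (F.P K) 0 (Matrix.unitaryGroup (Fin 2) ℂ)) (A : PBond (F.P K) 0 → Matrix (Fin 2) (Fin 2) ℂ),
              -- the seven conjuncts of `P1FlatPillarAt' F n K (cubeSeqMT3 …) (cubeSetM x (K−n) ρ S M 0) x ε₀ ε₁ B₁ 6 C₂' U` for THIS pair `(u, A)` ((ii′) on `□₀`)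
              DP1Clause F n K (cubeSeqMT3 F n K x ρ S M hM) x U u →
              (∀ b : PBond (F.P K) 0, IsSelfAdjoint (A b)) → (∀ b : PBond (F.P K) 0, Matrix.trace (A b) = 0) →
              (∀ (z : B7Prop1Explicit.Site (F.P K).d) (μ : Fin (F.P K).d),
                transl (0 : Site (F.P K) 0) z ∈ cubeSetM x (K - n) ρ S M 0 → (transl (0 : Site (F.P K) 0) z).shift μ ∈ cubeSetM x (K - n) ρ S M 0 →
                (Unitary.toUnits (u (transl 0 z)))⁻¹ * unitsField (toUField U) ⟨transl 0 z, μ⟩ * Unitary.toUnits (u ((transl 0 z).shift μ)) =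
                  expUnit (I • ((((F.L : ℝ)⁻¹) ^ (K - n)) • A ⟨transl 0 z, μ⟩))) →
              (∀ w : ℕ → PBond (F.P K) 0 → ℝ, IsLevWeight F n K (cubeSeqMT3 F n K x ρ S M hM) w →
                (∀ b : PBond (F.P K) 0, w 1 b * ‖A b‖ ≤ B₁ * ε₀) ∧
                (∀ (b : PBond (F.P K) 0) (ν : Fin (F.P K).d), w 2 b * (F.L : ℝ) ^ (K - n) * ‖A ⟨b.src.shift ν, b.dir⟩ - A b‖ ≤ B₁ * ε₀)) →
              (∃ μ : SiteIdx (cubeSeqMT3 F n K x ρ S M hM) → Matrix (Fin 2) (Fin 2) ℂ, ∀ s : Site (F.P K) 0,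
                laplace ((F.L : ℝ) ^ (K - n)) (diverg ((F.L : ℝ) ^ (K - n)) A) s =
                  ∑ i : SiteIdx (cubeSeqMT3 F n K x ρ S M hM), siteAvgIter (i.1.1 : ℕ) (Pi.single s (1 : ℝ)) i.1.2 • μ i) →
              (∀ c : BondIdx (cubeSeqMT3 F n K x ρ S M hM), (c.1.1 : ℕ) = K - n →
                c.1.2.src ∈ (cubeSeqMT3 F n K x ρ S M hM).Om (c.1.1 : ℕ) → c.1.2.tgt ∈ (cubeSeqMT3 F n K x ρ S M hM).Om (c.1.1 : ℕ) →
                ‖chartLogFlat (((F.L : ℝ)⁻¹) ^ (K - n)) (cubeSeqMT3 F n K x ρ S M hM) A c‖ ≤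
                  6 * ε₁ * (distSite (Mk (F.P K) (c.1.1 : ℕ)) c.1.2.src (iterBlockOf (c.1.1 : ℕ) x) + 1)) →
              (∀ c : BondIdx (cubeSeqMT3 F n K x ρ S M hM), ‖chartLogFlat (((F.L : ℝ)⁻¹) ^ (K - n)) (cubeSeqMT3 F n K x ρ S M hM) A c‖ ≤ C₂' * ε₀) →
              -- OUTPUT: `sitePackage_of_rows`'s rows for some `Hs`, `C`, `e₁`, `e₃`
              ∃ (Hs : (BondIdx (cubeSeqMT3 F n K x ρ S M hM) → Matrix (Fin 2) (Fin 2) ℂ) → (PBond (F.P K) 0 → Matrix (Fin 2) (Fin 2) ℂ))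
                (C : (PBond (F.P K) 0 → Matrix (Fin 2) (Fin 2) ℂ) → (BondIdx (cubeSeqMT3 F n K x ρ S M hM) → Matrix (Fin 2) (Fin 2) ℂ))
                (e₁ e₃ : ℝ),
                ((∀ (z : B7Prop1Explicit.Site (F.P K).d) (τ : Fin (F.P K).d),
                    SideTouches (pullDom (fun j => if K - n ≤ j then ({x} : Set (Site (F.P K) 0)) else (∅ : Set (Site (F.P K) 0))) (K - n)) z τ →
                    ‖((A + Hs (C A)) - fun b : PBond (F.P K) 0 => ∑ c, flatH F n K (cubeSeqMT3 F n K x ρ S M hM) (Pi.single c 1) b •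
                        bondAvgIter (c.1.1 : ℕ) (A + Hs (C A)) c.1.2) ⟨transl 0 z, τ⟩‖ ≤ e₁) ∧
                  (∀ (z : B7Prop1Explicit.Site (F.P K).d) (κ τ : Fin (F.P K).d),
                    SideTouches (pullDom (fun j => if K - n ≤ j then ({x} : Set (Site (F.P K) 0)) else (∅ : Set (Site (F.P K) 0))) (K - n)) z τ →
                    ‖(((F.L : ℝ)⁻¹) ^ (K - n))⁻¹ •
                      (((A + Hs (C A)) - fun b : PBond (F.P K) 0 => ∑ c, flatH F n K (cubeSeqMT3 F n K x ρ S M hM) (Pi.single c 1) b •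
                          bondAvgIter (c.1.1 : ℕ) (A + Hs (C A)) c.1.2) ⟨(transl 0 z).shift κ, τ⟩ -
                        ((A + Hs (C A)) - fun b : PBond (F.P K) 0 => ∑ c, flatH F n K (cubeSeqMT3 F n K x ρ S M hM) (Pi.single c 1) b •
                          bondAvgIter (c.1.1 : ℕ) (A + Hs (C A)) c.1.2) ⟨transl 0 z, τ⟩)‖ ≤ e₁) ∧
                  (∀ (z : B7Prop1Explicit.Site (F.P K).d) (μ : Fin (F.P K).d),
                    BondTouches (pullDom (fun j => if K - n ≤ j then ({x} : Set (Site (F.P K) 0)) else (∅ : Set (Site (F.P K) 0))) (K - n)) z μ →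
                    ‖pdiv (((F.L : ℝ)⁻¹) ^ (K - n)) (1 : B7Prop1Explicit.Site (F.P K).d → Fin (F.P K).d → (Matrix (Fin 2) (Fin 2) ℂ)ˣ)
                        (plaqCovDeriv (((F.L : ℝ)⁻¹) ^ (K - n)) (1 : B7Prop1Explicit.Site (F.P K).d → Fin (F.P K).d → (Matrix (Fin 2) (Fin 2) ℂ)ˣ)
                          (pull ((A + Hs (C A)) - fun b : PBond (F.P K) 0 => ∑ c, flatH F n K (cubeSeqMT3 F n K x ρ S M hM) (Pi.single c 1) b •
                            bondAvgIter (c.1.1 : ℕ) (A + Hs (C A)) c.1.2) 0)) μ z‖ ≤ e₁)) ∧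
                ((∀ (z : B7Prop1Explicit.Site (F.P K).d) (τ : Fin (F.P K).d),
                    SideTouches (pullDom (fun j => if K - n ≤ j then ({x} : Set (Site (F.P K) 0)) else (∅ : Set (Site (F.P K) 0))) (K - n)) z τ →
                    ‖Hs (C A) ⟨transl 0 z, τ⟩‖ ≤ e₃) ∧
                  (∀ (z : B7Prop1Explicit.Site (F.P K).d) (κ τ : Fin (F.P K).d),
                    SideTouches (pullDom (fun j => if K - n ≤ j then ({x} : Set (Site (F.P K) 0)) else (∅ : Set (Site (F.P K) 0))) (K - n)) z τ →
                    ‖(((F.L : ℝ)⁻¹) ^ (K - n))⁻¹ • (Hs (C A) ⟨(transl 0 z).shift κ, τ⟩ - Hs (C A) ⟨transl 0 z, τ⟩)‖ ≤ e₃) ∧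
                  (∀ (z : B7Prop1Explicit.Site (F.P K).d) (μ : Fin (F.P K).d),
                    BondTouches (pullDom (fun j => if K - n ≤ j then ({x} : Set (Site (F.P K) 0)) else (∅ : Set (Site (F.P K) 0))) (K - n)) z μ →
                    ‖pdiv (((F.L : ℝ)⁻¹) ^ (K - n)) (1 : B7Prop1Explicit.Site (F.P K).d → Fin (F.P K).d → (Matrix (Fin 2) (Fin 2) ℂ)ˣ)
                        (plaqCovDeriv (((F.L : ℝ)⁻¹) ^ (K - n)) (1 : B7Prop1Explicit.Site (F.P K).d → Fin (F.P K).d → (Matrix (Fin 2) (Fin 2) ℂ)ˣ)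
                          (pull (Hs (C A)) 0)) μ z‖ ≤ e₃)) ∧
                (∀ c : BondIdx (cubeSeqMT3 F n K x ρ S M hM), (c.1.1 : ℕ) = K - n →
                  c.1.2.src ∈ (cubeSeqMT3 F n K x ρ S M hM).Om (c.1.1 : ℕ) → c.1.2.tgt ∈ (cubeSeqMT3 F n K x ρ S M hM).Om (c.1.1 : ℕ) →
                  ‖bondAvgIter (c.1.1 : ℕ) (A + Hs (C A)) c.1.2‖ ≤ 6 * ε₁ * (distSite (Mk (F.P K) (c.1.1 : ℕ)) c.1.2.src (iterBlockOf (c.1.1 : ℕ) x) + 1)) ∧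
                (∀ c : BondIdx (cubeSeqMT3 F n K x ρ S M hM),
                  ¬ ((c.1.1 : ℕ) = K - n ∧ c.1.2.src ∈ (cubeSeqMT3 F n K x ρ S M hM).Om (c.1.1 : ℕ) ∧
                      c.1.2.tgt ∈ (cubeSeqMT3 F n K x ρ S M hM).Om (c.1.1 : ℕ)) →
                  ‖bondAvgIter (c.1.1 : ℕ) (A + Hs (C A)) c.1.2‖ ≤ c₂ * (B₁ + 1) * ε₀ * (F.L : ℝ) ^ ((K - n) - (c.1.1 : ℕ))) ∧
                e₁ ≤ k₁ * (B₁ + 1) ^ 2 * ε₀ ^ 2 ∧ e₃ ≤ k₂ * (B₁ + 1) ^ 2 * ε₀ ^ 2) :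
    ∀ L : ℕ, 1 < L → ∃ (N : ℕ) (B₃ a₅ : ℝ), 4 < B₃ ∧ 0 < a₅ ∧
      ∀ F : T3Family, F.L = L → ∀ (n K : ℕ) (hnK : n < K), N ≤ F.L ^ (F.m + n) →
        ∀ (ε₀ ε₁ : ℝ), 0 < ε₁ → 0 < ε₀ → ε₀ ≤ a₅ →
          ∀ V : GaugeField (F.P n) 0 (Matrix.specialUnitaryGroup (Fin 2) ℂ), PlaqSmall ε₁ V →
            ∀ U ∈ regFibrePr F n K hnK.le ε₀ V,
              (∀ γ : ℝ → GaugeField (F.P K) 0 (Matrix.specialUnitaryGroup (Fin 2) ℂ), γ 0 = U → (∀ t, γ t ∈ fibre F ℰp n K hnK.le V) →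
                (∀ b, DifferentiableAt ℝ (fun t => ((γ t b : Matrix.specialUnitaryGroup (Fin 2) ℂ) : Matrix (Fin 2) (Fin 2) ℂ)) 0) →
                  deriv (fun t => wilsonAction4 (γ t)) 0 = 0) →
                RegPr F n K (max (B₃ * ε₁) (ε₀ / 2)) U := by
  intro L hL
  by_cases hodd : Odd L
  swap
  · -- even `L`: no member, the minimiser form is vacuous
    exact ⟨0, 5, 1, by norm_num, one_pos, fun F hF => absurd (hF ▸ F.hL.1) hodd⟩
  -- the P2 text and its constants
  obtain ⟨R₀, M₀, B₀, δ₀, B₃, hB₀, hδ₀, hB₃, hP2L⟩ := hP2 L hodd hL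
  -- the C_E thresholds (growth-exposed edition)
  obtain ⟨M₁, R₁, hCE₁⟩ := hCEgrowth L hodd hL R₀ M₀ B₀ δ₀ B₃ hB₀ hδ₀ hB₃ hP2L
  -- the P1♭ supplier's floors
  obtain ⟨Mₚ, Rₚ, sx, ρ₅, Cθ, hP1₁⟩ := hP1roomρ5 L hodd hL
  -- the geometry of the cube sequence: `M = L^{aₑ} ≥ max (max M₁ M₀) Mₚ`, `R = max (max R₁ R₀) (max 1 Rₚ)`, `S = R·M`
  set aₑ : ℕ := max (max (max M₁ M₀) Mₚ) (sx + 1) with haₑ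
  set M : ℕ := L ^ aₑ with hMdef
  have hL2 : 2 ≤ L := hL
  have hpow' : aₑ ≤ L ^ aₑ := (Nat.lt_pow_self (by omega)).le
  have hpow : max (max M₁ M₀) Mₚ ≤ L ^ aₑ := (le_max_left _ _).trans hpow'
  have hsx : sx + 1 ≤ aₑ := le_max_right _ _
  have hM₁M : M₁ ≤ M := ((le_max_left _ _).trans (le_max_left _ _)).trans hpow
  have hM₀M : M₀ ≤ M := ((le_max_right _ _).trans (le_max_left _ _)).trans hpow
  have hMₚM : Mₚ ≤ M := (le_max_right _ _).trans hpow
  have hM1 : 1 ≤ M := Nat.one_le_pow _ _ (by omega)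
  set R : ℕ := max (max R₁ R₀) (max 1 Rₚ) with hRdef
  have hR1 : 1 ≤ R := (le_max_left _ _).trans (le_max_right _ _)
  have hRₚR : Rₚ ≤ R := (le_max_right _ _).trans (le_max_right _ _)
  set S : ℕ := R * M with hSdef
  -- P1♭'s BASE size constant `B₁` (read ρ-polynomially below), room letter and ρ-window constant (all ρ-free)
  obtain ⟨B₁, hB₁, Nr, Cρ, hCρ, qρ, hP1L⟩ := hP1₁ R M aₑ S hM1 rfl hMₚM hRₚR le_rfl
  -- the C_E floor letter and GROWTH constants (ρ-free, B₁-free)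
  obtain ⟨Nce, k₁, k₂, c₂, ace, hk₁, hk₂, hc₂, hace, hCE₂⟩ :=
    hCE₁ R M aₑ S hM1 rfl hM₁M hM₀M ((le_max_left _ _).trans (le_max_left _ _)) ((le_max_right _ _).trans (le_max_left _ _)) le_rfl
  -- the inner radius `ρ` by the POLYNOMIAL (163): the package constant grows at most linearly in `ρ` through `C₂ = c₂·(B₁(ρ+1) + 1)`
  have hBB : 0 < B₀ * B₃ := mul_pos hB₀ hB₃
  have hT₀ : 0 ≤ 4 * (B₀ * B₃) * (12 + c₂) + 8 := by positivity
  have hT₁ : 0 ≤ 4 * (B₀ * B₃) * (c₂ * B₁) := by positivity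
  -- prefix «ρ5»: `ρ` above the supplier's floor `ρ₅` AND in the residue class `ρ ≡ −L [L^{sx+1}]` (★w3-20520 g8's `exists_rho_163_pow_ge_mod`)
  have hmpos : 0 < L ^ (sx + 1) := pow_pos (by omega) _
  obtain ⟨ρ, hρ₅, hρ2, hρmod, h163lin⟩ := exists_rho_163_pow_ge_mod hδ₀ hT₀ hT₁ qρ ρ₅ hmpos (L ^ (sx + 1) - L % L ^ (sx + 1))
  have hdivρL : L ^ (sx + 1) ∣ ρ + L := by
    rw [Nat.dvd_iff_mod_eq_zero, Nat.add_mod, hρmod]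
    rcases Nat.eq_zero_or_pos (L % L ^ (sx + 1)) with h0 | hpos
    · rw [h0, Nat.sub_zero, Nat.mod_self, Nat.zero_add, Nat.zero_mod]
    · rw [Nat.mod_eq_of_lt (Nat.sub_lt hmpos hpos), Nat.sub_add_cancel (Nat.mod_lt _ hmpos).le, Nat.mod_self]
  have hdiv : L ^ (sx + 1) ∣ ρ + M + L + S := by
    have hM' : L ^ (sx + 1) ∣ M := by rw [hMdef]; exact pow_dvd_pow L hsx
    have hS' : L ^ (sx + 1) ∣ S := by rw [hSdef]; exact hM'.mul_left R
    have hsum : ρ + M + L + S = (ρ + L) + (M + S) := by omega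
    rw [hsum]; exact hdivρL.add (hM'.add hS')
  have hρ1 : 1 ≤ ρ := by
    have : (1 : ℝ) ≤ (ρ : ℝ) := by linarith
    exact_mod_cast this
  have hρr1 : (1 : ℝ) ≤ ((ρ : ℝ) + 1) ^ qρ := one_le_pow₀ (by linarith)
  have hρr0 : (0 : ℝ) ≤ ((ρ : ℝ) + 1) ^ qρ := by positivity
  -- the size constant AT THIS `ρ` and the C_E constants it generates
  set B₁ρ : ℝ := B₁ * ((ρ : ℝ) + 1) ^ qρ with hB₁ρdef
  have hB₁ρ : 0 ≤ B₁ρ := mul_nonneg hB₁ hρr0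
  set K₁ : ℝ := k₁ * (B₁ρ + 1) ^ 2 with hK₁def
  set K₂ : ℝ := k₂ * (B₁ρ + 1) ^ 2 with hK₂def
  set C₂ : ℝ := c₂ * (B₁ρ + 1) with hC₂def
  set aCE : ℝ := ace / (B₁ρ + 1) with haCEdef
  have hK₁ : 0 ≤ K₁ := by positivity
  have hK₂ : 0 ≤ K₂ := by positivity
  have hC₂ : 0 ≤ C₂ := by positivity
  have haCE : 0 < aCE := by positivity
  -- the package constant `C′`
  set C' : ℝ := max (max 12 C₂) (2 / (B₀ * B₃)) with hC'def
  have hC'12 : (12 : ℝ) ≤ C' := (le_max_left _ _).trans (le_max_left _ _)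
  have hC'C₂ : C₂ ≤ C' := (le_max_right _ _).trans (le_max_left _ _)
  have hC'ce : 2 / (B₀ * B₃) ≤ C' := le_max_right _ _
  have hC'0 : 0 ≤ C' := by linarith
  have hCBB2 : (2 : ℝ) ≤ C' * (B₀ * B₃) := by
    have := (div_le_iff₀ hBB).1 hC'ce
    linarith
  -- `4C′B₀B₃ ≤ T₀ + T₁(ρ+1)` (`package_const_le`), hence (163) at this `ρ`
  have hTle : 4 * C' * B₀ * B₃ ≤ (4 * (B₀ * B₃) * (12 + c₂) + 8) + 4 * (B₀ * B₃) * (c₂ * B₁) * ((ρ : ℝ) + 1) ^ qρ := by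
    rw [hC'def, hC₂def, hB₁ρdef]
    exact package_const_le hBB hc₂ hB₁ hρr1
  have h163 : 4 * C' * B₀ * B₃ * Real.exp (-(δ₀ / 2 * ((ρ : ℝ) - 2))) ≤ 1 / 2 :=
    (mul_le_mul_of_nonneg_right hTle (Real.exp_pos _).le).trans h163lin
  -- the ratio `Cr = 4C′B₀B₃` and the ceiling `a` (after `ρ`)
  set Cr : ℝ := max (4 * C' * B₀ * B₃) (Cθ * ((ρ + M + L + S : ℕ) : ℝ)) with hCrdef
  have hCr4ring : (4 : ℝ) * C' * B₀ * B₃ = 4 * (C' * (B₀ * B₃)) := by ring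
  have h4le : 4 * C' * B₀ * B₃ ≤ Cr := by rw [hCrdef]; exact le_max_left _ _
  have hCθ' : Cθ * ((ρ + M + L + S : ℕ) : ℝ) ≤ Cr := by rw [hCrdef]; exact le_max_right _ _
  have hCr8 : (8 : ℝ) ≤ Cr := le_trans (by rw [hCr4ring]; linarith) h4le
  have hCr : 0 < Cr := by linarith
  have hρM : 0 < 12 * ((ρ : ℝ) + (M : ℝ)) := by positivity
  have hden : 0 < 16 * 3800 * ((5 * L : ℕ) : ℝ) ^ 2 * (L : ℝ) * (B₁ρ + 1) := by
    have : (0 : ℝ) < L := by exact_mod_cast (by omega : 0 < L)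
    have : (0 : ℝ) < ((5 * L : ℕ) : ℝ) := by positivity
    positivity
  have hρ1C : 0 < Cρ * ((ρ : ℝ) + 1) ^ qρ := by positivity
  set a : ℝ := min (min aCE (min (Cr / (12 * ((ρ : ℝ) + (M : ℝ)))) (1 / (16 * 3800 * ((5 * L : ℕ) : ℝ) ^ 2 * (L : ℝ) * (B₁ρ + 1)))))
    (1 / (Cρ * ((ρ : ℝ) + 1) ^ qρ)) with hadef
  have ha : 0 < a := lt_min (lt_min haCE (lt_min (div_pos hCr hρM) (div_pos one_pos hden))) (div_pos one_pos hρ1C)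
  have haCE' : a ≤ aCE := (min_le_left _ _).trans (min_le_left _ _)
  have hreg₁ : 12 * ((ρ : ℝ) + (M : ℝ)) * a ≤ Cr := by
    have h1 : a ≤ Cr / (12 * ((ρ : ℝ) + (M : ℝ))) := (min_le_left _ _).trans ((min_le_right _ _).trans (min_le_left _ _))
    have := (le_div_iff₀ hρM).1 h1
    linarith
  have hreg₀ : 16 * 3800 * ((5 * L : ℕ) : ℝ) ^ 2 * (L : ℝ) * ((B₁ * ((ρ : ℝ) + 1) ^ qρ + 1) * a) ≤ 1 := by
    have h1 : a ≤ 1 / (16 * 3800 * ((5 * L : ℕ) : ℝ) ^ 2 * (L : ℝ) * (B₁ρ + 1)) :=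
      (min_le_left _ _).trans ((min_le_right _ _).trans (min_le_right _ _))
    have := (le_div_iff₀ hden).1 h1
    linarith
  -- the ρ-window (RULING L-11 v3): `Cρ·(ρ+1)^qρ·a ≤ 1` by the fourth `min`-term
  have hregρ : Cρ * ((ρ : ℝ) + 1) ^ qρ * a ≤ 1 := by
    have h1 : a ≤ 1 / (Cρ * ((ρ : ℝ) + 1) ^ qρ) := min_le_right _ _
    have := (le_div_iff₀ hρ1C).1 h1
    linarith
  -- P1♭ at these constants, at the members with room
  have hCr4 : 4 < Cr := by linarith
  have hP1' := hP1L ρ a Cr hCr hCr4 hreg₁ hCθ' hdiv hρ₅ hreg₀ hregρ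
  -- the stub's constants: `B₃ := Cr`, `a₅ := exists_a5 (K₁ + K₂ + 1) a`, floor `N := max (2ρ + Nr) Nce`
  have hKc : (0 : ℝ) ≤ K₁ + K₂ + 1 := by positivity
  obtain ⟨a₅, ha₅, ha₅a, ha₅90, hKa⟩ := Prop8LastMile.exists_a5 hKc ha
  refine ⟨max (2 * ρ + Nr) Nce, Cr, a₅, hCr4, ha₅, ?_⟩
  have hR₀R : R₀ ≤ R := (le_max_right R₁ R₀).trans (le_max_left _ _)
  have hS1 : 1 ≤ S := by
    show 1 ≤ R * M
    exact Nat.one_le_iff_ne_zero.mpr (Nat.mul_ne_zero (by omega) (by omega))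
  have hRS : R * M ≤ S := le_rfl
  intro F hF n K hnK hN ε₀ ε₁ hε₁ hε₀ hε₀a₅ V hV U hU hstat
  have hNr : 2 * ρ + Nr ≤ F.L ^ (F.m + n) := (le_max_left _ _).trans hN
  have hNce : Nce ≤ F.L ^ (F.m + n) := (le_max_right _ _).trans hN
  have hUreg : RegPr F n K ε₀ U := ((mem_regFibrePr_iff F).mp hU).2
  have hε₀a : ε₀ ≤ a := hε₀a₅.trans ha₅a
  -- P1♭ → (u, A) → hCEstat → the package → P2 at the cube sequence → the (167)-chart at every site → §1
  refine regPrHalving_of_memberCharts (Kc := K₁ + K₂ + 1) hCr hKc ha₅90 hKa hε₁ hε₀ hε₀a₅ U hUreg fun hreg x => ?_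
  -- P1♭ at the member and the site
  obtain ⟨u, A, ho, hsa, htr, hii, hiii, hiv, hvi, hvii⟩ := hP1' F hF n K hnK hNr ε₀ ε₁ hε₁ hε₀ hε₀a hreg.le V hV U hU x
  have hii_mem : ∀ j, 1 ≤ j → j ≤ K - n → ∀ (z : B7Prop1Explicit.Site (F.P K).d) (μ : Fin (F.P K).d),
      SideTouches (pullDom (fun i => {y : Site (F.P K) 0 | (cubeSeqMT3 F n K x ρ S M hM1).InOm i y}) j) z μ →
      (Unitary.toUnits (u (transl 0 z)))⁻¹ * unitsField (toUField U) ⟨transl 0 z, μ⟩ * Unitary.toUnits (u ((transl 0 z).shift μ)) =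
        expUnit (I • ((((F.L : ℝ)⁻¹) ^ (K - n)) • A ⟨transl 0 z, μ⟩)) :=
    fun j h1 hjk z μ hz => hii z μ (sideTouches_subset_cube0 x ρ S M hM1 hS1 j h1 hjk z μ hz).1
      (sideTouches_subset_cube0 x ρ S M hM1 hS1 j h1 hjk z μ hz).2
  -- the C_E rows
  obtain ⟨Hs, C, e₁, e₃, h165, h157, hnear, hfar, he₁, he₃⟩ :=
    hCE₂ B₁ρ hB₁ρ ρ hρ1 F hF n K hnK hNce ε₀ ε₁ hε₁ hε₀ (hε₀a.trans haCE') V hV U hU hstat x _ u A ho hsa htr hii hiii hiv hvi hvii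
  -- the package at the site
  obtain ⟨u', A', A₁, Rm, B, hA, hchart, hdec, hnear', hfar', s₁, g₁, d₁, s₃, g₃, d₃⟩ :=
    sitePackage_of_rows x ρ S M hM1 U u A Hs C hsa (layerChart_of_memberChart hnK x ρ S M hM1 hii_mem) h165 h157 hnear hfar he₁ he₃
  -- P2 at the cube sequence centred at `x`, with the canonical level weights
  have hAdm : Adm22 (cubeSeqMT3 F n K x ρ S M hM1) R M := adm22_cubeSeqMT3 F n K x ρ hM1 hRS
  have hw : IsLevWeight F n K (cubeSeqMT3 F n K x ρ S M hM1)
      (fun m b => ((F.L : ℝ) ^ levOf (fun j => {y : Site (F.P K) 0 | (cubeSeqMT3 F n K x ρ S M hM1).InOm j y}) (K - n) b.src *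
        ((F.L : ℝ)⁻¹) ^ (K - n)) ^ m) := fun _ _ => rfl
  obtain ⟨H, Gt, hFH, -, -, -, -, dBI, hdom, h162, hHd⟩ :=
    hP2L F hF n K hnK R M hR₀R hM₀M ⟨aₑ, hMdef⟩ (cubeSeqMT3 F n K x ρ S M hM1) rfl hAdm _ hw
  -- the text's `H` IS the canonical `flatH`
  have hHeq : H = flatH F n K (cubeSeqMT3 F n K x ρ S M hM1) :=
    LinearMap.ext fun X => funext fun b =>
      (hFH X b).trans (isFlatH_flatH (F := F) (n := n) (K := K) (D := cubeSeqMT3 F n K x ρ S M hM1) X b).symm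
  rw [hHeq] at hHd
  -- the per-site clause of the (167)-chart schema
  have hε₀2 : 0 < ε₀ ^ 2 := by positivity
  have hρR : (0 : ℝ) ≤ (ρ : ℝ) - 2 := by linarith only [hρ2]
  have h163' : 4 * C' * B₀ * B₃ * Real.exp (-(δ₀ / 2 * ((ρ : ℝ) - 2))) ≤ 1 / 2 := h163
  have hα₂ : K₁ * ε₀ ^ 2 + 1 / 4 * max (4 * C' * B₀ * B₃ * ε₁) (ε₀ / 2) + K₂ * ε₀ ^ 2 <
      1 / 4 * max (Cr * ε₁) (ε₀ / 2) + (K₁ + K₂ + 1) * ε₀ ^ 2 := by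
    have hmax : max (4 * C' * B₀ * B₃ * ε₁) (ε₀ / 2) ≤ max (Cr * ε₁) (ε₀ / 2) :=
      max_le_max (mul_le_mul_of_nonneg_right h4le hε₁.le) le_rfl
    linarith only [hε₀2, hmax]
  exact siteClause_of_pieces_int hnK x ρ S M hM1 hw hdom hHd h162 hδ₀.le hB₀.le hB₃.le (C₁ := 6) (C := C') (by norm_num) (by linarith) hC'C₂
    hε₁.le hε₀.le hρR h163' le_rfl hα₂ U u' hA hchart (fun _ => rfl) hdec hnear' hfar' s₁ g₁ d₁ s₃ g₃ d₃

end Door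

/-! ## §2 ★★★ The one-hypothesis H door, ρ-window edition -/

open SmallMembersCoverLiftTangent (statLift)
open SmallMembersCoverLiftStub (stub_of_roomHalvingStat)
open HalvingStepOfPillarsRoomStatDoor (roomStubTextStat_of_roomHalvingStat)
open FlatOpsAdmAtMSAllL (hP2_holds)

/-- ★★★ **THE ONE-HYPOTHESIS H DOOR, PREFIX «ρ5»**: the registered text of `BirthV10.stub_halvingStep` from the roomed P1♭ pillar `hP1roomρ5` ALONE —
✓`stub_halvingStep_of_hP1roomρ4`'s hypothesis with, per `L`, `∃ (Mₚ Rₚ sx ρ₅ : ℕ) (Cθ : ℝ)` and the three antecedents `Cθ * ((ρ + M + L + S : ℕ) : ℝ) ≤ Cr →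
L ^ (sx + 1) ∣ ρ + M + L + S → ρ₅ ≤ ρ →` inserted after `12(ρ+M)a ≤ Cr →`; the H-SMALL cover lift (✓`statLift`), the P2 text (✓`hP2_holds`) and the growth-exposed
C_E rows (✓`HalvingSitePackage.ceRows_of_chart_stat_growth_room`) discharged by name, as in ✓`…Rho4`.
INHABITABILITY (OWNER №9 (3)): supplier — ✓`HalvingP1FlatPillarRoomOfSuppliersRho5.hP1roomρ5_of_suppliers` ∘ (the ρ5 pass-through twins of ✓`hSupUρ4_of_memberPacks` ∘ packs,
to be lettered) and, trivially, any ρ4 supplier at `sx := 0, ρ₅ := 0, Cθ := 0`; door — kernel (§1).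
[cite: Balaban1985Variational, Thm 1 p.279, (150)-(168) pp.301-304, Prop. 8 p.304; Balaban1985RegularSpaces, Thm 2 p.83, (1.33)-(1.38) p.82, p.98] -/
theorem stub_halvingStep_of_hP1roomρ5
    (hP1roomρ5 : ∀ L : ℕ, Odd L → 1 < L → ∃ (Mₚ Rₚ sx ρ₅ : ℕ) (Cθ : ℝ), ∀ (R M aₑ S : ℕ) (hM : 1 ≤ M), M = L ^ aₑ → Mₚ ≤ M → Rₚ ≤ R → R * M ≤ S →
      ∃ B₁ : ℝ, 0 ≤ B₁ ∧ ∃ Nr : ℕ, ∃ Cρ : ℝ, 0 < Cρ ∧ ∃ qρ : ℕ,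
      ∀ (ρ : ℕ) (a Cr : ℝ), 0 < Cr → 4 < Cr → 12 * ((ρ : ℝ) + (M : ℝ)) * a ≤ Cr → Cθ * ((ρ + M + L + S : ℕ) : ℝ) ≤ Cr → L ^ (sx + 1) ∣ ρ + M + L + S → ρ₅ ≤ ρ →
        16 * 3800 * ((5 * L : ℕ) : ℝ) ^ 2 * (L : ℝ) * ((B₁ * ((ρ : ℝ) + 1) ^ qρ + 1) * a) ≤ 1 → Cρ * ((ρ : ℝ) + 1) ^ qρ * a ≤ 1 →
        ∀ F : T3Family, F.L = L → ∀ (n K : ℕ) (hnK : n < K), 2 * ρ + Nr ≤ F.L ^ (F.m + n) →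
          ∀ (ε₀ ε₁ : ℝ), 0 < ε₁ → 0 < ε₀ → ε₀ ≤ a → Cr * ε₁ ≤ ε₀ →
          ∀ V : GaugeField (F.P n) 0 (Matrix.specialUnitaryGroup (Fin 2) ℂ), PlaqSmall ε₁ V →
            ∀ U ∈ regFibrePr F n K hnK.le ε₀ V, ∀ x : Site (F.P K) 0,
              P1FlatPillarAt' F n K (cubeSeqMT3 F n K x ρ S M hM) (cubeSetM x (K - n) ρ S M 0) x ε₀ ε₁ (B₁ * ((ρ : ℝ) + 1) ^ qρ) 6
                (8 * (L : ℝ) * (B₁ * ((ρ : ℝ) + 1) ^ qρ + 1)) U) :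
    ∀ (L : ℕ), 1 < L → ∃ B₃ : ℝ, 4 < B₃ ∧ ∃ a₅ : ℝ, 0 < a₅ ∧
      ∀ (i : Idx L) (ε₀ ε₁ : ℝ), 0 < ε₁ → ∀ (V : (famX L i).Bdry) (U : (famX L i).Cfg), (famX L i).Reg7 ε₁ V → (famX L i).InU ε₀ U →
        (famX L i).InB V U → (famX L i).IsCritical V U → ε₀ ≤ a₅ → (famX L i).InU (max (B₃ * ε₁) (ε₀ / 2)) U :=
  stub_of_roomHalvingStat statLift (roomStubTextStat_of_roomHalvingStat (roomHalvingStat_of_rows_rho5 hP2_holds hP1roomρ5 ceRows_of_chart_stat_growth_room))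


end Summit.QuantumFields.YangMills.Theorems.HalvingStubOfHP1RoomRho5

end
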